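import Summits.HodgeConjecture.HodgeConjecture.Theses.HeckePrymWeil
import Summits.HodgeConjecture.HodgeConjecture.Theorems.HeckePrymWeilAimedDescendingOfAimedSplitProduct
import Summits.HodgeConjecture.HodgeConjecture.Theorems.HeckePrymWeilEightfoldDescentGlue
import Literature.AlgebraicGeometry.Motives.AimedSplitProduct
import HarnessLib

/-!
# Crux `WeilSixfoldsSqrtMinus7` (stmt-HodgeConjecture-1260), line `hyperbolic-eightfold-descent` — the r4 composition: `HyperbolicEightfoldsSqrtMinus7 → WeilSixfoldsSqrtMinus7` given the AIMED PARTNER at `d = 7`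

Route `HeckePrymWeil`. The crux: on every complex abelian SIXFOLD `A` with `φ ≫ φ = -7` every
rational `(3,3)`-class in the Weil span `Eig((𝟙+φ)^*, (1+i√7)⁶) ⊔ Eig((𝟙+φ)^*, (1-i√7)⁶)` is
algebraic — ALL discriminants `det H ∈ ℚ^×/Nm(ℚ(√-7)^×)` (open mathematics off `det H = -1`:
Markman arXiv:2502.03415 Thm 1.5.1 covers the split component only; arXiv:2603.20268 §1).

The line's cycle-1 composition (`Theorems/HeckePrymWeilWeilSixfoldsSqrtMinus7OfHyperbolicEightfolds`,
`weilSixfoldsSqrtMinus7_of_hyperbolicEightfolds`) was conditional on TWO named facts: de Rham's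
theorem in multiplicative form — since DISCHARGED (`exists_deRhamIsoFamily_holds`) — and the aiming
lemma `Motives.exists_cmWeilSurface_aimedSplitProduct` — since found MISSTATED (false at `d ∈ {1,3}`,
`Motives/AimedSplitProduct` `## Misstatement`) and re-filed, guarded, as
`Motives.exists_cmWeilSurface_aimedSplitProduct_of_ne_one_of_ne_three`. This file is the line's
RESHAPE r4 of that composition, on the tree's real carriers and sorry-free:

* `weilSixfoldsSqrtMinus7_of_hyperbolicEightfolds_of_aimedPartnerSeven` — **the crux from the split
  EIGHTFOLD crux `HyperbolicEightfoldsSqrtMinus7` (item 14642) and the AIMED PARTNER AT `d = 7`**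
  (the line's registered stub S7 `stub_aimedPartnerSeven`, verbatim as hypothesis): for every Weil-type
  `(A, φ)` of dimension `2n` with `φ ≫ φ = -7` a partner surface `(B, ψ)` with a DESCENT PAIR and a
  projective embedding of `A × B` for whose `K`-symmetrised hyperplane class `(A × B, φ × ψ)` is
  hyperbolic in half-dimension `n + 1`. Proof: the case `c = 0`; S7 at `n = 3`; `dim (A × B) = 8`,
  `(φ × ψ)² = -7`; the eightfold crux on the product; Schoen's transfer for a GIVEN partner with a
  descent pair, `Theorems.productDescentAt_of_descentPair` (item 14643 file XIII, unconditional: real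
  Gysin `complexGysin`, projection formula, Künneth, de Rham multiplicative).
* `aimedPartnerSeven_of_aimedSplitProduct` — the corrected named fact implies S7 (`7 ∉ {1, 3}`;
  instantiate `d = 7`, let the partner depend on `(A, φ)`; casts `((7:ℕ) : ℤ/ℝ/ℂ) = 7`).
* `weilSixfoldsSqrtMinus7_of_hyperbolicEightfolds_of_aimedSplitProduct` — **the crux from the
  eightfold crux and the corrected named fact alone** (= the landed glue `eightfoldDescentGlue_proof`
  fed `aimedDescending_of_aimedSplitProduct`): what the cycle-1 composition becomes after the de Rham
  discharge and the re-filing of the fact.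

What this does NOT do: it does not touch `HyperbolicEightfoldsSqrtMinus7` (item 14642, the deciding
open case: Markman's Question 8.2.4 at `d = 7`; its line hinges on `WeilVariationalHodge (7,4)`), nor
discharge the aimed partner (needs the CM curve `E₀`, `ι ≫ ι = -7`, as an `AbelianVariety ℂ`
endomorphism, Hodge–Riemann in degree one, weighted Segre embeddings on `complexBetti`); so it closes
nothing. It records that the sixfold crux for ALL discriminants is, in Lean and on the real carriers,
the split EIGHTFOLD crux plus the aimed partner at `d = 7`.

Sources: Markman2025SurveySecant §11.5 Step 2; Schoen1998HodgeWeilAddendum §10; Koike2004WeilHodge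
Thm 2.1; vanGeemen1994HodgeAV 5.2–5.4.
-/

noncomputable section

-- every declaration of this problem lives in `Summit.HodgeConjecture.HodgeConjecture.…`
set_option linter.dupNamespace false

open CategoryTheory
open Literature.AlgebraicGeometry Literature.AlgebraicGeometry.Motives
  Literature.AlgebraicGeometry.HodgeTheory Literature.AlgebraicTopology.SingularHomology
open Summit.HodgeConjecture.HodgeConjecture.Theses.HeckePrymWeil

namespace Summit.HodgeConjecture.HodgeConjecture.Theorems.WeilSixfoldsSqrtMinus7.HyperbolicEightfoldDescent

/-- **The crux from the split eightfold crux and the aimed partner at `d = 7`** (line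
`hyperbolic-eightfold-descent`, composition r4; the first hypothesis is VERBATIM the registered stub
S7 `stub_aimedPartnerSeven`, the second the route decl `HyperbolicEightfoldsSqrtMinus7` = stub S1).
Given a sixfold `(A, φ)`, `φ ≫ φ = -7`, and a rational `(3,3)` Weil class `c`: if `c = 0` it is
algebraic; otherwise `c` witnesses Weil type and S7 at `n = 3` yields the partner surface `(B, ψ)`
with its descent pair `(b₊, b₋, η)` and an embedding `e` of `A × B` with a rational `a ≠ 0` making
`(A × B, φ × ψ)` hyperbolic in half-dimension `4` for `7·e^*a + (φ×ψ)^*e^*a`; `dim (A × B) = 8`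
(`dim_prod`), `(φ × ψ)² = -7` (`prodLift_comp_self_eq_neg_zsmul`), so the eightfold crux makes every
rational `(4,4)` Weil class of the product algebraic, and Schoen's transfer
`productDescentAt_of_descentPair` (Schoen 1998 §10; Markman arXiv:2509.23403 §11.5 Step 2) returns `c`.
[cite: Schoen1998HodgeWeilAddendum, §10 (Proposition and proof)] [cite: Markman2025SurveySecant, §11.5 Step 2] -/
theorem weilSixfoldsSqrtMinus7_of_hyperbolicEightfolds_of_aimedPartnerSeven :
    (∀ (n : ℕ) (A : AbelianVariety ℂ) (φ : A ⟶ A), 1 ≤ n → A.dim = 2 * n → φ ≫ φ = -((7 : ℤ) • 𝟙 A) →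
      (∃ c : complexBetti A.X (2 * n), c ≠ 0 ∧ IsRationalClass c ∧
        IsOfHodgeType (2 * n) A.X (2 * n) n n c ∧
        c ∈ Module.End.eigenspace (complexBetti.map (𝟙 A + φ).hom.hom.hom (2 * n)).hom
              ((1 + Complex.I * (Real.sqrt (7 : ℝ) : ℂ)) ^ (2 * n)) ⊔
            Module.End.eigenspace (complexBetti.map (𝟙 A + φ).hom.hom.hom (2 * n)).hom
              ((1 - Complex.I * (Real.sqrt (7 : ℝ) : ℂ)) ^ (2 * n))) →
      ∃ (B : AbelianVariety ℂ) (ψ : B ⟶ B), B.dim = 2 ∧ ψ ≫ ψ = -((7 : ℤ) • 𝟙 B) ∧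
        (∃ bp bm η : complexBetti B.X 2,
          bp ∈ Module.End.eigenspace (complexBetti.map (𝟙 B + ψ).hom.hom.hom 2).hom
                ((1 + Complex.I * (Real.sqrt (7 : ℝ) : ℂ)) ^ 2) ∧
          bm ∈ Module.End.eigenspace (complexBetti.map (𝟙 B + ψ).hom.hom.hom 2).hom
                ((1 - Complex.I * (Real.sqrt (7 : ℝ) : ℂ)) ^ 2) ∧
          IsRationalClass (bp + bm) ∧ IsOfHodgeType 2 B.X 2 1 1 (bp + bm) ∧
          η ∈ algebraicClasses B.X 1 ∧
          cupProduct (show 2 + 2 = 4 from rfl) bp η ≠ 0 ∧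
          cupProduct (show 2 + 2 = 4 from rfl) bm η ≠ 0) ∧
        ∃ (e : ProjectiveEmbedding (A.prod B).X) (a : complexBetti (projectiveSpace e.n ℂ) 2),
          IsRationalClass a ∧ a ≠ 0 ∧
          IsHyperbolicWeilType (A.prod B)
            (AbelianVariety.prodLift (AbelianVariety.fst A B ≫ φ) (AbelianVariety.snd A B ≫ ψ))
            (n + 1)
            ((7 : ℂ) • complexBetti.map e.ι 2 a +
              complexBetti.map (AbelianVariety.prodLift (AbelianVariety.fst A B ≫ φ)
                (AbelianVariety.snd A B ≫ ψ)).hom.hom.hom 2 (complexBetti.map e.ι 2 a))) →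
    HyperbolicEightfoldsSqrtMinus7 → WeilSixfoldsSqrtMinus7 := by
  intro h₇ h₁ A φ hA hφ c hrat hH hW
  by_cases hc : c = 0
  · rw [hc]
    exact Submodule.zero_mem _
  obtain ⟨B, ψ, hB, hψ, ⟨bp, bm, η, hbp, hbm, hbr, hbH, hη, hpη, hmη⟩, e, a, ha, ha0, hhyp⟩ :=
    h₇ 3 A φ (by norm_num) hA hφ ⟨c, hc, hrat, hH, hW⟩
  have hdim : (A.prod B).dim = 8 := by rw [AbelianVariety.dim_prod, hA, hB]
  have hφ' : φ ≫ φ = -(((7 : ℕ) : ℤ) • 𝟙 A) := by exact_mod_cast hφ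
  have hψ' : ψ ≫ ψ = -(((7 : ℕ) : ℤ) • 𝟙 B) := by exact_mod_cast hψ
  have hsq := Summit.HodgeConjecture.HodgeConjecture.Theorems.prodLift_comp_self_eq_neg_zsmul hφ' hψ'
  have halg := h₁ (A.prod B) _ hdim (by exact_mod_cast hsq) e a ha ha0 hhyp
  exact Summit.HodgeConjecture.HodgeConjecture.Theorems.productDescentAt_of_descentPair
    (p := 7) (n := 3) (by norm_num) (by norm_num) φ hA ψ hB
    (by exact_mod_cast hbp) (by exact_mod_cast hbm) hbr hbH hη hpη hmη
    (by exact_mod_cast halg) hrat hH (by exact_mod_cast hW)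

/-- **The corrected named fact implies the aimed partner at `d = 7`** (the registered stub S7,
verbatim as conclusion): instantiate
`Motives.exists_cmWeilSurface_aimedSplitProduct_of_ne_one_of_ne_three` at `d = 7` (`7 > 0`,
`7 ≠ 1`, `7 ≠ 3`) and let the one CM Weil surface it provides serve every `(A, φ)`; the casts
`((7 : ℕ) : ℤ) = 7`, `√((7 : ℕ) : ℝ) = √7`, `((7 : ℕ) : ℂ) = 7` are definitional up to `Nat.cast_ofNat`.
[cite: Markman2025SurveySecant, §11.5 Step 2] [cite: vanGeemen1994HodgeAV, Lemma 5.2 (3), 5.3 and 5.4 (5.4.1)] -/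
theorem aimedPartnerSeven_of_aimedSplitProduct :
    exists_cmWeilSurface_aimedSplitProduct_of_ne_one_of_ne_three →
    ∀ (n : ℕ) (A : AbelianVariety ℂ) (φ : A ⟶ A), 1 ≤ n → A.dim = 2 * n → φ ≫ φ = -((7 : ℤ) • 𝟙 A) →
      (∃ c : complexBetti A.X (2 * n), c ≠ 0 ∧ IsRationalClass c ∧
        IsOfHodgeType (2 * n) A.X (2 * n) n n c ∧
        c ∈ Module.End.eigenspace (complexBetti.map (𝟙 A + φ).hom.hom.hom (2 * n)).hom
              ((1 + Complex.I * (Real.sqrt (7 : ℝ) : ℂ)) ^ (2 * n)) ⊔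
            Module.End.eigenspace (complexBetti.map (𝟙 A + φ).hom.hom.hom (2 * n)).hom
              ((1 - Complex.I * (Real.sqrt (7 : ℝ) : ℂ)) ^ (2 * n))) →
      ∃ (B : AbelianVariety ℂ) (ψ : B ⟶ B), B.dim = 2 ∧ ψ ≫ ψ = -((7 : ℤ) • 𝟙 B) ∧
        (∃ bp bm η : complexBetti B.X 2,
          bp ∈ Module.End.eigenspace (complexBetti.map (𝟙 B + ψ).hom.hom.hom 2).hom
                ((1 + Complex.I * (Real.sqrt (7 : ℝ) : ℂ)) ^ 2) ∧
          bm ∈ Module.End.eigenspace (complexBetti.map (𝟙 B + ψ).hom.hom.hom 2).hom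
                ((1 - Complex.I * (Real.sqrt (7 : ℝ) : ℂ)) ^ 2) ∧
          IsRationalClass (bp + bm) ∧ IsOfHodgeType 2 B.X 2 1 1 (bp + bm) ∧
          η ∈ algebraicClasses B.X 1 ∧
          cupProduct (show 2 + 2 = 4 from rfl) bp η ≠ 0 ∧
          cupProduct (show 2 + 2 = 4 from rfl) bm η ≠ 0) ∧
        ∃ (e : ProjectiveEmbedding (A.prod B).X) (a : complexBetti (projectiveSpace e.n ℂ) 2),
          IsRationalClass a ∧ a ≠ 0 ∧
          IsHyperbolicWeilType (A.prod B)
            (AbelianVariety.prodLift (AbelianVariety.fst A B ≫ φ) (AbelianVariety.snd A B ≫ ψ))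
            (n + 1)
            ((7 : ℂ) • complexBetti.map e.ι 2 a +
              complexBetti.map (AbelianVariety.prodLift (AbelianVariety.fst A B ≫ φ)
                (AbelianVariety.snd A B ≫ ψ)).hom.hom.hom 2 (complexBetti.map e.ι 2 a)) := by
  intro hX n A φ _hn hA hφ hw
  obtain ⟨B, ψ, hB, hψ, hpair, hAim⟩ := hX 7 (by norm_num) (by norm_num) (by norm_num)
  obtain ⟨e, a, ha, ha0, hhyp⟩ := hAim n A φ hA (by exact_mod_cast hφ) (by exact_mod_cast hw)
  exact ⟨B, ψ, hB, by exact_mod_cast hψ, by exact_mod_cast hpair, e, a, ha, ha0, by exact_mod_cast hhyp⟩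

/-- **The crux from the split eightfold crux and the corrected named fact alone**: the landed glue
`eightfoldDescentGlue_proof : HyperbolicEightfoldsSqrtMinus7 → AimedDescending → WeilSixfoldsSqrtMinus7`
(item 14751) fed the lever `aimedDescending_of_aimedSplitProduct` (item 14643, closed modulo the
fact). This is what the cycle-1 composition `weilSixfoldsSqrtMinus7_of_hyperbolicEightfolds`
(conditional on the unguarded, misstated fact and on de Rham) becomes after the de Rham discharge and
the re-filing of the aiming lemma under the guard `d ∉ {1, 3}`.
[cite: Markman2025SurveySecant, §11.5 Step 2] [cite: Schoen1998HodgeWeilAddendum, §10] -/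
theorem weilSixfoldsSqrtMinus7_of_hyperbolicEightfolds_of_aimedSplitProduct :
    exists_cmWeilSurface_aimedSplitProduct_of_ne_one_of_ne_three →
    HyperbolicEightfoldsSqrtMinus7 → WeilSixfoldsSqrtMinus7 :=
  fun hX h8 => Summit.HodgeConjecture.HodgeConjecture.Theorems.eightfoldDescentGlue_proof h8
    (Summit.HodgeConjecture.HodgeConjecture.Theorems.aimedDescending_of_aimedSplitProduct hX)

end Summit.HodgeConjecture.HodgeConjecture.Theorems.WeilSixfoldsSqrtMinus7.HyperbolicEightfoldDescent

end
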